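import Summits.KontsevichZagierPeriods.KontsevichZagierPeriods.Theorems.SoloBlindBoxRing
import Summits.KontsevichZagierPeriods.KontsevichZagierPeriods.Theorems.SoloBlindDimLeOne
import HarnessLib

/-!
# The box sector of the Kontsevich–Zagier conjecture, II: generators of the box algebra

In the formal period ring `Q = FormalRep ⧸ relations` (`SoloBlindBoxRing`) we single out the
classes of the unit cells

* `ℓ(μ) = [L(1; μ)] = [[1, μ], dx/x]` (value `log μ`) and
* `a(t) = [A(1; t)] = [[0, t], dx/(1+x²)]` (value `arctan t`),

show that a cell with algebraic coefficient is a scalar multiple of the unit cell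
(`[L(c; μ)] = c • ℓ(μ)`, `[A(d; t)] = d • a(t)`: the coefficient is a point-cell factor, up to a
re-indexing move), that `ℚ`-linear relations among logarithms (resp. arctangents) of real algebraic
numbers hold between the `ℓ(μ)` (resp. `a(t)`) in `Q` (from `SoloBlindCellRelations`), and that the
class of every element of the **box ring** — the non-unital subring of `FormalRep` generated by the
rational integral representations of dimension `≤ 1` — lies in the `K₀`-subalgebra of `Q` generated
by finitely many `ℓ(μ)` (`μ > 1`) and `a(t)` (`t > 0`) (`exists_genData_of_mem_boxRing`; the
dimension-`≤ 1` normal form is `SoloBlindDimLeOne.isCellSum_of_isRational_of_le_one`).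

References: M. Kontsevich, D. Zagier, *Periods* (2001), §1.1–1.2.
-/

noncomputable section

open MeasureTheory Set
open scoped BigOperators

namespace Summit.KontsevichZagierPeriods.KontsevichZagierPeriods.Theorems

open Literature.NumberTheory.Transcendental
open Literature.NumberTheory.Transcendental.KZ

namespace SoloBlind

/-! ## Scalars -/

/-- `κ` on an explicit real algebraic number is the class of its point cell. -/
theorem kappa_mk (c : ℝ) (hc : IsAlgebraic ℚ c) :
    kappa ⟨c, mem_K₀_iff.mpr hc⟩ = mkQ (of (constCell c hc)) := rfl

/-- Scalar multiplication by `β ∈ K₀` is multiplication by the point-cell class `κ(β)`. -/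
theorem smul_eq_kappa_mul (β : K₀) (x : Q) : β • x = kappa β * x := Algebra.smul_def β x

/-- The point-cell class `[K(c)]` is the scalar `c • 1`. -/
theorem mkQ_constCell (c : ℝ) (hc : IsAlgebraic ℚ c) :
    mkQ (of (constCell c hc)) = (⟨c, mem_K₀_iff.mpr hc⟩ : K₀) • (1 : Q) := by
  rw [smul_eq_kappa_mul, mul_one, kappa_mk]

/-- Rational numbers in `K₀` coerce to `ℝ` as expected. -/
theorem coe_ratCast_K₀ (q : ℚ) : ((q : K₀) : ℝ) = q := rfl

/-! ## The unit cells `ℓ(μ)` and `a(t)` -/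

open scoped Classical in
/-- The unit logarithmic class `ℓ(μ) = [L(1; μ)] ∈ Q` (and `0` if `μ` is not algebraic). -/
def ell (μ : ℝ) : Q :=
  if h : IsAlgebraic ℚ μ then mkQ (of (logCell 1 μ isAlgebraic_one h)) else 0

open scoped Classical in
/-- The unit arctangent class `a(t) = [A(1; t)] ∈ Q` (and `0` if `t` is not algebraic). -/
def alpha (t : ℝ) : Q :=
  if h : IsAlgebraic ℚ t then mkQ (of (atanCell 1 t isAlgebraic_one h)) else 0

/-- Unfolding `ℓ(μ)` at an algebraic `μ`. -/
theorem ell_eq {μ : ℝ} (hμ : IsAlgebraic ℚ μ) :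
    ell μ = mkQ (of (logCell 1 μ isAlgebraic_one hμ)) := by
  rw [ell, dif_pos hμ]

/-- Unfolding `a(t)` at an algebraic `t`. -/
theorem alpha_eq {t : ℝ} (ht : IsAlgebraic ℚ t) :
    alpha t = mkQ (of (atanCell 1 t isAlgebraic_one ht)) := by
  rw [alpha, dif_pos ht]

/-- `evalQ ℓ(μ) = log μ` for algebraic `μ ≥ 1`. -/
theorem evalQ_ell {μ : ℝ} (hμ : IsAlgebraic ℚ μ) (h1 : 1 ≤ μ) : evalQ (ell μ) = Real.log μ := by
  rw [ell_eq hμ, evalQ_mkQ, eval_of, value_logCell h1, one_mul]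

/-- `evalQ a(t) = arctan t` for algebraic `t ≥ 0`. -/
theorem evalQ_alpha {t : ℝ} (ht : IsAlgebraic ℚ t) (h0 : 0 ≤ t) :
    evalQ (alpha t) = Real.arctan t := by
  rw [alpha_eq ht, evalQ_mkQ, eval_of, value_atanCell h0, one_mul]

section scalar

variable {c μ d t : ℝ} (hc : IsAlgebraic ℚ c) (hμ : IsAlgebraic ℚ μ) (hd : IsAlgebraic ℚ d)
  (ht : IsAlgebraic ℚ t)

/-- `L(c; μ)` re-indexed along `Fin 1 ≃ Fin (0 + 1)` is `K(c) × L(1; μ)`, as representations. -/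
theorem logCell_reindex_eq_constCell_prod :
    (logCell c μ hc hμ).reindex (finCongr (Nat.zero_add 1).symm) =
      (constCell c hc).prod (logCell 1 μ isAlgebraic_one hμ) := by
  refine IntegralRep.ext' ?_ ?_
  · ext w
    simp only [IntegralRep.reindex_domain, mem_setOf_eq, finCongr_zero_add_symm_apply,
      IntegralRep.prod_domain, IntegralRep.mem_prodDomain, constCell_domain, mem_univ, true_and,
      logCell_eq, logSeg_domain, mem_line]
  · ext w
    simp only [IntegralRep.reindex_integrand, finCongr_zero_add_symm_apply, logCell_eq,
      logSeg_integrand, IntegralRep.prod_integrand_eq, IntegralRep.prodFun_apply,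
      constCell_integrand]
    ring

/-- `A(d; t)` re-indexed along `Fin 1 ≃ Fin (0 + 1)` is `K(d) × A(1; t)`, as representations. -/
theorem atanCell_reindex_eq_constCell_prod :
    (atanCell d t hd ht).reindex (finCongr (Nat.zero_add 1).symm) =
      (constCell d hd).prod (atanCell 1 t isAlgebraic_one ht) := by
  refine IntegralRep.ext' ?_ ?_
  · ext w
    simp only [IntegralRep.reindex_domain, mem_setOf_eq, finCongr_zero_add_symm_apply,
      IntegralRep.prod_domain, IntegralRep.mem_prodDomain, constCell_domain, mem_univ, true_and,
      atanCell_eq, atanSeg_domain, mem_line]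
  · ext w
    simp only [IntegralRep.reindex_integrand, finCongr_zero_add_symm_apply, atanCell_eq,
      atanSeg_integrand, IntegralRep.prod_integrand_eq, IntegralRep.prodFun_apply,
      constCell_integrand]
    ring

/-- **A logarithmic cell is a scalar multiple of the unit cell**: `[L(c; μ)] = c • ℓ(μ)` in `Q`. -/
theorem mkQ_logCell :
    mkQ (of (logCell c μ hc hμ)) = (⟨c, mem_K₀_iff.mpr hc⟩ : K₀) • ell μ := by
  rw [smul_eq_kappa_mul, kappa_mk c hc, ell_eq hμ, ← mkQ_mul, of_mul_of,
    ← logCell_reindex_eq_constCell_prod hc hμ, mkQ_eq_mkQ_iff]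
  exact of_sub_of_reindex_mem_relations _ _

/-- **An arctangent cell is a scalar multiple of the unit cell**: `[A(d; t)] = d • a(t)` in `Q`. -/
theorem mkQ_atanCell :
    mkQ (of (atanCell d t hd ht)) = (⟨d, mem_K₀_iff.mpr hd⟩ : K₀) • alpha t := by
  rw [smul_eq_kappa_mul, kappa_mk d hd, alpha_eq ht, ← mkQ_mul, of_mul_of,
    ← atanCell_reindex_eq_constCell_prod hd ht, mkQ_eq_mkQ_iff]
  exact of_sub_of_reindex_mem_relations _ _

end scalar

/-! ## Rational relations among the unit cells -/

/-- **`ℚ`-linear relations among logarithms hold between the `ℓ(μ)` in `Q`.**  If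
`Σ_i N_i log λ_i = 0` with `N_i ∈ ℚ` and `λ_i > 1` real algebraic then `Σ_i N_i • ℓ(λ_i) = 0`
(`SoloBlindCellRelations.sum_logCell_ratCoeff_mem_relations`). -/
theorem sum_ratCast_smul_ell_eq_zero {ι : Type} [Fintype ι] (N : ι → ℚ) (l : ι → ℝ)
    (hla : ∀ i, IsAlgebraic ℚ (l i)) (h1 : ∀ i, 1 < l i)
    (hrel : ∑ i, (N i : ℝ) * Real.log (l i) = 0) :
    ∑ i, ((N i : ℚ) : K₀) • ell (l i) = 0 := by
  have hc : ∀ i, IsAlgebraic ℚ ((1 : ℝ) * N i) := fun i => by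
    rw [one_mul]; exact isAlgebraic_algebraMap (N i)
  have h := sum_logCell_ratCoeff_mem_relations 1 isAlgebraic_one N l hla h1 hrel (hc := hc)
  rw [← mkQ_eq_zero_iff, map_sum] at h
  rw [← h]
  refine Finset.sum_congr rfl fun i _ => ?_
  rw [mkQ_logCell (hc i) (hla i)]
  congr 1
  apply Subtype.ext
  show ((N i : K₀) : ℝ) = (1 : ℝ) * (N i : ℝ)
  rw [coe_ratCast_K₀, one_mul]

/-- **`ℚ`-linear relations among arctangents hold between the `a(t)` in `Q`.**  If
`Σ_i N_i arctan τ_i = 0` with `N_i ∈ ℚ` and `τ_i > 0` real algebraic then `Σ_i N_i • a(τ_i) = 0`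
(`SoloBlindCellRelations.sum_atanCell_ratCoeff_mem_relations`). -/
theorem sum_ratCast_smul_alpha_eq_zero {ι : Type} [Fintype ι] (N : ι → ℚ) (τ : ι → ℝ)
    (hτa : ∀ i, IsAlgebraic ℚ (τ i)) (h0 : ∀ i, 0 < τ i)
    (hrel : ∑ i, (N i : ℝ) * Real.arctan (τ i) = 0) :
    ∑ i, ((N i : ℚ) : K₀) • alpha (τ i) = 0 := by
  have hc : ∀ i, IsAlgebraic ℚ ((1 : ℝ) * N i) := fun i => by
    rw [one_mul]; exact isAlgebraic_algebraMap (N i)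
  have h := sum_atanCell_ratCoeff_mem_relations 1 isAlgebraic_one N τ hτa h0 hrel (hc := hc)
  rw [← mkQ_eq_zero_iff, map_sum] at h
  rw [← h]
  refine Finset.sum_congr rfl fun i _ => ?_
  rw [mkQ_atanCell (hc i) (hτa i)]
  congr 1
  apply Subtype.ext
  show ((N i : K₀) : ℝ) = (1 : ℝ) * (N i : ℝ)
  rw [coe_ratCast_K₀, one_mul]

/-- **Expressing `ℓ(μ)` in a family**: if `log μ = Σ_k c_k log u_k` with `c_k ∈ ℚ` and
`μ, u_k > 1` real algebraic, then `ℓ(μ) = Σ_k c_k • ℓ(u_k)` in `Q`. -/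
theorem ell_eq_sum_smul {κ : Type} [Fintype κ] {μ : ℝ} (hμ : IsAlgebraic ℚ μ) (h1 : 1 < μ)
    (u : κ → ℝ) (hu : ∀ k, IsAlgebraic ℚ (u k)) (hu1 : ∀ k, 1 < u k) (c : κ → ℚ)
    (h : ∑ k, (c k : ℝ) * Real.log (u k) = Real.log μ) :
    ell μ = ∑ k, ((c k : ℚ) : K₀) • ell (u k) := by
  have hrel : ∑ o : Option κ, ((o.elim (-1) c : ℚ) : ℝ) * Real.log (o.elim μ u) = 0 := by
    rw [Fintype.sum_option]
    simp only [Option.elim, h, Rat.cast_neg, Rat.cast_one, neg_one_mul, neg_add_cancel]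
  have := sum_ratCast_smul_ell_eq_zero (fun o : Option κ => o.elim (-1) c) (fun o => o.elim μ u)
    (fun o => by cases o <;> simp [Option.elim, hμ, hu])
    (fun o => by cases o <;> simp [Option.elim, h1, hu1]) hrel
  rw [Fintype.sum_option] at this
  simp only [Option.elim, Rat.cast_neg, Rat.cast_one, neg_smul, one_smul] at this
  rwa [neg_add_eq_zero] at this

/-- **Expressing `a(t)` in a family**: if `arctan t = Σ_k c_k arctan θ_k` with `c_k ∈ ℚ` and
`t, θ_k > 0` real algebraic, then `a(t) = Σ_k c_k • a(θ_k)` in `Q`. -/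
theorem alpha_eq_sum_smul {κ : Type} [Fintype κ] {t : ℝ} (ht : IsAlgebraic ℚ t) (h0 : 0 < t)
    (θ : κ → ℝ) (hθ : ∀ k, IsAlgebraic ℚ (θ k)) (hθ0 : ∀ k, 0 < θ k) (c : κ → ℚ)
    (h : ∑ k, (c k : ℝ) * Real.arctan (θ k) = Real.arctan t) :
    alpha t = ∑ k, ((c k : ℚ) : K₀) • alpha (θ k) := by
  have hrel : ∑ o : Option κ, ((o.elim (-1) c : ℚ) : ℝ) * Real.arctan (o.elim t θ) = 0 := by
    rw [Fintype.sum_option]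
    simp only [Option.elim, h, Rat.cast_neg, Rat.cast_one, neg_one_mul, neg_add_cancel]
  have := sum_ratCast_smul_alpha_eq_zero (fun o : Option κ => o.elim (-1) c) (fun o => o.elim t θ)
    (fun o => by cases o <;> simp [Option.elim, ht, hθ])
    (fun o => by cases o <;> simp [Option.elim, h0, hθ0]) hrel
  rw [Fintype.sum_option] at this
  simp only [Option.elim, Rat.cast_neg, Rat.cast_one, neg_smul, one_smul] at this
  rwa [neg_add_eq_zero] at this

/-! ## The box ring and finite generating data -/

/-- The generators of the **box ring**: (classes of) rational integral representations of
dimension `≤ 1`. -/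
def dimLeOneGens : Set FormalRep :=
  {x | ∃ (n : ℕ) (r : IntegralRep n), n ≤ 1 ∧ r.IsRational ∧ x = of r}

/-- The **box ring**: the (non-unital) subring of `FormalRep` generated by the rational integral
representations of dimension `≤ 1` — all `ℤ`-combinations of Fubini products
`[σ₁ × ⋯ × σ_k, f₁ ⊗ ⋯ ⊗ f_k]` of such representations. -/
def boxRing : NonUnitalSubring FormalRep := NonUnitalSubring.closure dimLeOneGens

/-- A rational representation of dimension `≤ 1` lies in the box ring. -/
theorem of_mem_boxRing {n : ℕ} (r : IntegralRep n) (hn : n ≤ 1) (hr : r.IsRational) :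
    of r ∈ boxRing :=
  NonUnitalSubring.subset_closure ⟨n, r, hn, hr, rfl⟩

/-- Finite generating data: finitely many real algebraic `μ > 1` and `t > 0`. -/
structure GenData where
  /-- the arguments of the logarithmic unit cells -/
  L : Finset ℝ
  /-- the arguments of the arctangent unit cells -/
  T : Finset ℝ
  /-- each `μ ∈ L` is real algebraic and `> 1` -/
  hL : ∀ μ ∈ L, IsAlgebraic ℚ μ ∧ 1 < μ
  /-- each `t ∈ T` is real algebraic and `> 0` -/
  hT : ∀ t ∈ T, IsAlgebraic ℚ t ∧ 0 < t

namespace GenData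

/-- The unit-cell classes named by the data. -/
def gens (D : GenData) : Set Q := ell '' (D.L : Set ℝ) ∪ alpha '' (D.T : Set ℝ)

/-- The `K₀`-subalgebra of `Q` generated by the unit cells named by the data. -/
def adjoin (D : GenData) : Subalgebra K₀ Q := Algebra.adjoin K₀ D.gens

/-- The empty data. -/
def empty : GenData := ⟨∅, ∅, by simp, by simp⟩

/-- Union of two generating data. -/
def union (D E : GenData) : GenData :=
  ⟨D.L ∪ E.L, D.T ∪ E.T,
    fun μ hμ => (Finset.mem_union.mp hμ).elim (D.hL μ) (E.hL μ),
    fun t ht => (Finset.mem_union.mp ht).elim (D.hT t) (E.hT t)⟩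

/-- The left datum generates a subalgebra of the union's. -/
theorem adjoin_le_union_left (D E : GenData) : D.adjoin ≤ (D.union E).adjoin := by
  refine Algebra.adjoin_mono (union_subset_union (image_mono ?_) (image_mono ?_)) <;>
    simp [union]

/-- The right datum generates a subalgebra of the union's. -/
theorem adjoin_le_union_right (D E : GenData) : E.adjoin ≤ (D.union E).adjoin := by
  refine Algebra.adjoin_mono (union_subset_union (image_mono ?_) (image_mono ?_)) <;>
    simp [union]

/-- `ℓ(μ)` for `μ ∈ L` lies in the generated subalgebra. -/
theorem ell_mem_adjoin (D : GenData) {μ : ℝ} (hμ : μ ∈ D.L) : ell μ ∈ D.adjoin :=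
  Algebra.subset_adjoin (Or.inl ⟨μ, hμ, rfl⟩)

/-- `a(t)` for `t ∈ T` lies in the generated subalgebra. -/
theorem alpha_mem_adjoin (D : GenData) {t : ℝ} (ht : t ∈ D.T) : alpha t ∈ D.adjoin :=
  Algebra.subset_adjoin (Or.inr ⟨t, ht, rfl⟩)

end GenData

/-- A cell sum lies in the subalgebra generated by its unit cells. -/
theorem exists_genData_of_isCellSum {z : FormalRep} (hz : IsCellSum z) :
    ∃ D : GenData, mkQ z ∈ D.adjoin := by
  classical
  obtain ⟨ιL, ιA, _, _, α, hα, c, l, hc, hl, d, τ, hd, hτ, h1, h0, hrel⟩ := hz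
  let D : GenData :=
    ⟨Finset.univ.image l, Finset.univ.image τ,
      fun μ hμ => by
        obtain ⟨i, -, rfl⟩ := Finset.mem_image.mp hμ
        exact ⟨hl i, h1 i⟩,
      fun t ht => by
        obtain ⟨k, -, rfl⟩ := Finset.mem_image.mp ht
        exact ⟨hτ k, h0 k⟩⟩
  refine ⟨D, ?_⟩
  rw [mkQ_eq_mkQ_iff.mpr hrel, cellSum, map_add, map_add, map_sum, map_sum, mkQ_constCell]
  refine add_mem (add_mem (Subalgebra.smul_mem _ (one_mem _) _) (Subalgebra.sum_mem _ fun i _ => ?_))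
    (Subalgebra.sum_mem _ fun k _ => ?_)
  · rw [mkQ_logCell (hc i) (hl i)]
    exact Subalgebra.smul_mem _ (D.ell_mem_adjoin (Finset.mem_image_of_mem l (Finset.mem_univ i))) _
  · rw [mkQ_atanCell (hd k) (hτ k)]
    exact Subalgebra.smul_mem _
      (D.alpha_mem_adjoin (Finset.mem_image_of_mem τ (Finset.mem_univ k))) _

/-- **The class of every element of the box ring lies in the `K₀`-subalgebra of `Q` generated by
finitely many unit cells `ℓ(μ)` (`μ > 1`) and `a(t)` (`t > 0`).** -/
theorem exists_genData_of_mem_boxRing {z : FormalRep} (hz : z ∈ boxRing) :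
    ∃ D : GenData, mkQ z ∈ D.adjoin := by
  induction hz using NonUnitalSubring.closure_induction with
  | mem x hx =>
    obtain ⟨n, r, hn, hr, rfl⟩ := hx
    exact exists_genData_of_isCellSum (isCellSum_of_isRational_of_le_one r hn hr)
  | zero => exact ⟨GenData.empty, by rw [map_zero]; exact zero_mem _⟩
  | add x y _ _ hx hy =>
    obtain ⟨D, hD⟩ := hx
    obtain ⟨E, hE⟩ := hy
    exact ⟨D.union E, by
      rw [map_add]
      exact add_mem (D.adjoin_le_union_left E hD) (D.adjoin_le_union_right E hE)⟩
  | neg x _ hx =>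
    obtain ⟨D, hD⟩ := hx
    exact ⟨D, by rw [map_neg]; exact neg_mem hD⟩
  | mul x y _ _ hx hy =>
    obtain ⟨D, hD⟩ := hx
    obtain ⟨E, hE⟩ := hy
    exact ⟨D.union E, by
      rw [mkQ_mul]
      exact mul_mem (D.adjoin_le_union_left E hD) (D.adjoin_le_union_right E hE)⟩

end SoloBlind

end Summit.KontsevichZagierPeriods.KontsevichZagierPeriods.Theorems
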